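import Summits.Ventures.CertifiedQuantumChemistry.Rows.OrbitalRotationCovariance
import Literature.MathematicalPhysics.QuantumChemistry.ThreeIndexRelaxationBound
import HarnessLib

/-!
# Ventures/CertifiedQuantumChemistry — Rows/OrbitalRotationCovarianceT.lean: the three-index
# conditions `T1`, `T2`, `T2′` are COVARIANT under unitary rotations of the one-particle basis

HONEST FRAMING (verbatim): certified bounds for a stated model Hamiltonian in a stated basis; not a
claim about the real molecule beyond that model.

Seat rdm-B, ROWS courtesy file (theorems only; no `def`, no notation); the `T1`/`T2′` rung of
`Rows/OrbitalRotationCovariance.lean` (its 'NOT here' item) — the rung of the cell's strongest rows.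
For `U U† = 1` on the spin-orbital index type `ι`, `γ' = UγU†`, `Γ' = (U⊗U)Γ(U⊗U)†`:

* `t1Map_eq_kronecker` — the 33 printed terms of `T1` (Nakata et al. 2008 §II.A) in STRUCTURAL form:
  each is a reindexing of `1 ⊗ Γ`, `1 ⊗ 1 ⊗ γ` or `1 ⊗ 1 ⊗ 1` by one of the six permutations of the
  three orbital slots on the row and on the column side, with the printed sign;
  `t2Map_eq_kronecker` — the 7 terms of `T2`: `Γ ⊗ 1` re-associated, four slot swaps of `1 ⊗ S(Γ)`
  with the reshuffle `S(Γ)_{(jk),(mn)} = Γ^{nj}_{km}`, and `1 ⊗ 1 ⊗ γᵀ` with its slot swap;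
* `conj_submatrix_of_invariant`, `conj_submatrix_of_eq` — a congruence commutes with a reindexing
  that fixes (or re-presents) the congruence matrix; `kronecker₃_perm_invariant` — `U⊗U⊗U` is fixed
  by all six slot permutations; `reshuffle₂_conj`, `t2PrimeBlock₁₂_conj`, `t2PrimeBlock₂₁_conj` —
  the reshuffle and the two off-diagonal blocks of `T2′` re-pair their summation indices;
* **`t1Map_conj_unitary`** — `T1(γ', Γ') = (U⊗U⊗U) T1(γ, Γ) (U⊗U⊗U)†`;
  **`t2Map_conj_unitary`** — `T2(γ', Γ') = (U⊗U⊗Ū) T2(γ, Γ) (U⊗U⊗Ū)†` (two particle slots, one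
  hole slot; `Ū` the entrywise conjugate);
  **`t2PrimeMap_conj_unitary`** — `T2′(γ', Γ') = D T2′(γ, Γ) D†` with `D = (U⊗U⊗Ū) ⊕ U`
  (`Matrix.fromBlocks`; Nakata et al. 2008 §II.B);
* **`isDQGT1T2PrimeFeasible_conj_unitary`** — THE `PQGT1T2′`-FEASIBLE SET IS INVARIANT under every
  unitary one-particle rotation (`N`-electron form; the sector form and the optimal values are in
  `Rows/OrbitalRotationInvarianceT.lean`).

Everything is PROVED (0 sorry, standard axioms); no definitions, no named facts; nothing asserts a bound
about any model; no claim node. Method: the structural forms are checked entrywise (`ext`, the printed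
formula, `ring`); the covariance is then linear algebra — distribute the congruence over the terms,
move it through each slot permutation, and use `(A⊗B)(C⊗D) = AC ⊗ BD`, `U U† = 1`.

References: M. Nakata, B. J. Braams, K. Fujisawa, M. Fukuda, J. K. Percus, M. Yamashita, Z. Zhao,
J. Chem. Phys. 128 (2008) 164113 §II.A–B (`T1`, `T2`, `T2′`); D. A. Mazziotti, Adv. Chem. Phys. 134
(2007) ch. 3 §II.D.2 eqs. (37)–(45); P. W. Ayers, E. R. Davidson, ibid. ch. 16 §III.F eqs. (56)–(57).

Tree (REUSED): `t1Map_apply`, `t2Map_apply`, `t2PrimeMap`, `IsDQGT1T2PrimeFeasible`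
(`ThreeIndexRelaxationBound`); `mul_mul_apply`, `transpose_conj`, `map_star_mul_conjTranspose_of_unitary`,
`isDQGFeasible_conj_unitary` (`Rows/OrbitalRotationCovariance`). Mathlib: `Matrix.mul_kronecker_mul`,
`Matrix.conjTranspose_kronecker`, `Matrix.fromBlocks_multiply`, `Matrix.fromBlocks_conjTranspose`,
`Function.Bijective.sum_comp`, `Fintype.sum_equiv`.
-/

noncomputable section

namespace Summit.Ventures.CertifiedQuantumChemistry

open Matrix Finset
open Literature.MathematicalPhysics.QuantumLattice Literature.MathematicalPhysics.QuantumChemistry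
open scoped ComplexOrder Kronecker

/-! ## §1 Reindexing a congruence; the three-orbital Kronecker cube -/

section Reindex

variable {κ : Type*} [Fintype κ]

/-- **A congruence commutes with a simultaneous reindexing that fixes the congruence matrix**:
if `W_{f a, f b} = W_{ab}` and `W_{g a, g b} = W_{ab}` for bijections `f`, `g`, then
`W · M[f, g] · W† = (W M W†)[f, g]`. -/
theorem conj_submatrix_of_invariant (W : Matrix κ κ ℂ) {f g : κ → κ}
    (hf : Function.Bijective f) (hg : Function.Bijective g) (hWf : ∀ a b, W (f a) (f b) = W a b)
    (hWg : ∀ a b, W (g a) (g b) = W a b) (M : Matrix κ κ ℂ) :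
    W * M.submatrix f g * Wᴴ = (W * M * Wᴴ).submatrix f g := by
  ext x y
  rw [submatrix_apply, mul_mul_apply, mul_mul_apply]
  symm
  rw [← hg.sum_comp]
  refine Finset.sum_congr rfl fun s _ => ?_
  rw [← hf.sum_comp]
  refine Finset.sum_congr rfl fun t _ => ?_
  rw [submatrix_apply, conjTranspose_apply, conjTranspose_apply, hWf, hWg]

/-- The same for a reindexing INTO another index type: if `X_{ab} = V_{f a, f b}` for a bijection
`f : κ → κ'`, then `X · M[f, f] · X† = (V M V†)[f, f]`. -/
theorem conj_submatrix_of_eq {κ' : Type*} [Fintype κ'] (V : Matrix κ' κ' ℂ) {X : Matrix κ κ ℂ}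
    {f : κ → κ'} (hf : Function.Bijective f) (hX : ∀ a b, X a b = V (f a) (f b)) (M : Matrix κ' κ' ℂ) :
    X * M.submatrix f f * Xᴴ = (V * M * Vᴴ).submatrix f f := by
  ext x y
  rw [submatrix_apply, mul_mul_apply, mul_mul_apply]
  symm
  rw [← hf.sum_comp]
  refine Finset.sum_congr rfl fun s _ => ?_
  rw [← hf.sum_comp]
  refine Finset.sum_congr rfl fun t _ => ?_
  rw [submatrix_apply, conjTranspose_apply, conjTranspose_apply, hX, hX]

/-- Entries of a triple product of rectangular matrices as a double sum. -/
theorem mul_mul_apply' {α β γ δ : Type*} [Fintype β] [Fintype γ] (A : Matrix α β ℂ) (B : Matrix β γ ℂ)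
    (C : Matrix γ δ ℂ) (a : α) (d : δ) : (A * B * C) a d = ∑ x, ∑ y, A a y * B y x * C x d := by
  simp only [mul_apply, Finset.sum_mul]

end Reindex

section ThreeIndex

variable {ι : Type*} [LinearOrder ι] [Fintype ι]

omit [Fintype ι] in
/-- The identity matrix with the Kronecker delta written column-first (the orientation of the printed
`T1` / `T2` formulas). -/
theorem one_apply_symm (a b : ι) : (1 : Matrix ι ι ℂ) a b = if b = a then 1 else 0 := by
  rcases eq_or_ne a b with h | h
  · subst h
    rw [one_apply_eq, if_pos rfl]
  · rw [one_apply_ne h, if_neg (Ne.symm h)]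

omit [Fintype ι] in
/-- **Structural form of the `T1` functional** (Nakata et al. 2008 §II.A, all 33 printed terms): every
term is a row/column reindexing, by a permutation of the three orbital slots, of `1 ⊗ Γ` (one delta),
`1 ⊗ 1 ⊗ γ` (two deltas) or `1 ⊗ 1 ⊗ 1` (three deltas), with the sign of the printed formula. -/
theorem t1Map_eq_kronecker (γ : Matrix ι ι ℂ) (Γ : Matrix (ι × ι) (ι × ι) ℂ) :
    t1Map γ Γ =
      ((1 : Matrix ι ι ℂ) ⊗ₖ Γ)
      - ((1 : Matrix ι ι ℂ) ⊗ₖ Γ).submatrix (fun t : ι × ι × ι => (t.2.1, t.1, t.2.2)) id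
      + ((1 : Matrix ι ι ℂ) ⊗ₖ Γ).submatrix (fun t : ι × ι × ι => (t.2.2, t.1, t.2.1)) id
      - ((1 : Matrix ι ι ℂ) ⊗ₖ Γ).submatrix id (fun t : ι × ι × ι => (t.2.1, t.1, t.2.2))
      + ((1 : Matrix ι ι ℂ) ⊗ₖ Γ).submatrix (fun t : ι × ι × ι => (t.2.1, t.1, t.2.2)) (fun t : ι × ι × ι => (t.2.1, t.1, t.2.2))
      - ((1 : Matrix ι ι ℂ) ⊗ₖ Γ).submatrix (fun t : ι × ι × ι => (t.2.2, t.1, t.2.1)) (fun t : ι × ι × ι => (t.2.1, t.1, t.2.2))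
      + ((1 : Matrix ι ι ℂ) ⊗ₖ Γ).submatrix id (fun t : ι × ι × ι => (t.2.2, t.1, t.2.1))
      - ((1 : Matrix ι ι ℂ) ⊗ₖ Γ).submatrix (fun t : ι × ι × ι => (t.2.1, t.1, t.2.2)) (fun t : ι × ι × ι => (t.2.2, t.1, t.2.1))
      + ((1 : Matrix ι ι ℂ) ⊗ₖ Γ).submatrix (fun t : ι × ι × ι => (t.2.2, t.1, t.2.1)) (fun t : ι × ι × ι => (t.2.2, t.1, t.2.1))
      - ((1 : Matrix ι ι ℂ) ⊗ₖ ((1 : Matrix ι ι ℂ) ⊗ₖ γ))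
      + ((1 : Matrix ι ι ℂ) ⊗ₖ ((1 : Matrix ι ι ℂ) ⊗ₖ γ)).submatrix (fun t : ι × ι × ι => (t.1, t.2.2, t.2.1)) id
      + ((1 : Matrix ι ι ℂ) ⊗ₖ ((1 : Matrix ι ι ℂ) ⊗ₖ γ)).submatrix id (fun t : ι × ι × ι => (t.1, t.2.2, t.2.1))
      - ((1 : Matrix ι ι ℂ) ⊗ₖ ((1 : Matrix ι ι ℂ) ⊗ₖ γ)).submatrix (fun t : ι × ι × ι => (t.1, t.2.2, t.2.1)) (fun t : ι × ι × ι => (t.1, t.2.2, t.2.1))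
      + ((1 : Matrix ι ι ℂ) ⊗ₖ ((1 : Matrix ι ι ℂ) ⊗ₖ γ)).submatrix (fun t : ι × ι × ι => (t.2.1, t.1, t.2.2)) id
      - ((1 : Matrix ι ι ℂ) ⊗ₖ ((1 : Matrix ι ι ℂ) ⊗ₖ γ)).submatrix (fun t : ι × ι × ι => (t.2.1, t.2.2, t.1)) id
      - ((1 : Matrix ι ι ℂ) ⊗ₖ ((1 : Matrix ι ι ℂ) ⊗ₖ γ)).submatrix (fun t : ι × ι × ι => (t.2.1, t.1, t.2.2)) (fun t : ι × ι × ι => (t.1, t.2.2, t.2.1))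
      + ((1 : Matrix ι ι ℂ) ⊗ₖ ((1 : Matrix ι ι ℂ) ⊗ₖ γ)).submatrix (fun t : ι × ι × ι => (t.2.1, t.2.2, t.1)) (fun t : ι × ι × ι => (t.1, t.2.2, t.2.1))
      - ((1 : Matrix ι ι ℂ) ⊗ₖ ((1 : Matrix ι ι ℂ) ⊗ₖ γ)).submatrix (fun t : ι × ι × ι => (t.2.2, t.1, t.2.1)) id
      + ((1 : Matrix ι ι ℂ) ⊗ₖ ((1 : Matrix ι ι ℂ) ⊗ₖ γ)).submatrix (fun t : ι × ι × ι => (t.2.2, t.2.1, t.1)) id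
      + ((1 : Matrix ι ι ℂ) ⊗ₖ ((1 : Matrix ι ι ℂ) ⊗ₖ γ)).submatrix (fun t : ι × ι × ι => (t.2.2, t.1, t.2.1)) (fun t : ι × ι × ι => (t.1, t.2.2, t.2.1))
      - ((1 : Matrix ι ι ℂ) ⊗ₖ ((1 : Matrix ι ι ℂ) ⊗ₖ γ)).submatrix (fun t : ι × ι × ι => (t.2.2, t.2.1, t.1)) (fun t : ι × ι × ι => (t.1, t.2.2, t.2.1))
      - ((1 : Matrix ι ι ℂ) ⊗ₖ ((1 : Matrix ι ι ℂ) ⊗ₖ γ)).submatrix id (fun t : ι × ι × ι => (t.2.1, t.2.2, t.1))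
      + ((1 : Matrix ι ι ℂ) ⊗ₖ ((1 : Matrix ι ι ℂ) ⊗ₖ γ)).submatrix (fun t : ι × ι × ι => (t.1, t.2.2, t.2.1)) (fun t : ι × ι × ι => (t.2.1, t.2.2, t.1))
      + ((1 : Matrix ι ι ℂ) ⊗ₖ ((1 : Matrix ι ι ℂ) ⊗ₖ γ)).submatrix (fun t : ι × ι × ι => (t.2.1, t.1, t.2.2)) (fun t : ι × ι × ι => (t.2.1, t.2.2, t.1))
      - ((1 : Matrix ι ι ℂ) ⊗ₖ ((1 : Matrix ι ι ℂ) ⊗ₖ γ)).submatrix (fun t : ι × ι × ι => (t.2.1, t.2.2, t.1)) (fun t : ι × ι × ι => (t.2.1, t.2.2, t.1))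
      - ((1 : Matrix ι ι ℂ) ⊗ₖ ((1 : Matrix ι ι ℂ) ⊗ₖ γ)).submatrix (fun t : ι × ι × ι => (t.2.2, t.1, t.2.1)) (fun t : ι × ι × ι => (t.2.1, t.2.2, t.1))
      + ((1 : Matrix ι ι ℂ) ⊗ₖ ((1 : Matrix ι ι ℂ) ⊗ₖ γ)).submatrix (fun t : ι × ι × ι => (t.2.2, t.2.1, t.1)) (fun t : ι × ι × ι => (t.2.1, t.2.2, t.1))
      + ((1 : Matrix ι ι ℂ) ⊗ₖ ((1 : Matrix ι ι ℂ) ⊗ₖ (1 : Matrix ι ι ℂ)))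
      - ((1 : Matrix ι ι ℂ) ⊗ₖ ((1 : Matrix ι ι ℂ) ⊗ₖ (1 : Matrix ι ι ℂ))).submatrix (fun t : ι × ι × ι => (t.1, t.2.2, t.2.1)) id
      - ((1 : Matrix ι ι ℂ) ⊗ₖ ((1 : Matrix ι ι ℂ) ⊗ₖ (1 : Matrix ι ι ℂ))).submatrix (fun t : ι × ι × ι => (t.2.1, t.1, t.2.2)) id
      + ((1 : Matrix ι ι ℂ) ⊗ₖ ((1 : Matrix ι ι ℂ) ⊗ₖ (1 : Matrix ι ι ℂ))).submatrix (fun t : ι × ι × ι => (t.2.1, t.2.2, t.1)) id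
      + ((1 : Matrix ι ι ℂ) ⊗ₖ ((1 : Matrix ι ι ℂ) ⊗ₖ (1 : Matrix ι ι ℂ))).submatrix (fun t : ι × ι × ι => (t.2.2, t.1, t.2.1)) id
      - ((1 : Matrix ι ι ℂ) ⊗ₖ ((1 : Matrix ι ι ℂ) ⊗ₖ (1 : Matrix ι ι ℂ))).submatrix (fun t : ι × ι × ι => (t.2.2, t.2.1, t.1)) id := by
  ext ⟨i, j, k⟩ ⟨l, m, n⟩
  simp only [t1Map_apply, Matrix.sub_apply, Matrix.add_apply, submatrix_apply, id, kroneckerMap_apply,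
    one_apply_symm]
  ring

omit [LinearOrder ι] [Fintype ι] in
/-- The Kronecker cube `U ⊗ (U ⊗ U)` is invariant under every simultaneous permutation of the three
orbital slots (six permutations). -/
theorem kronecker₃_perm_invariant (U : Matrix ι ι ℂ) :
    (∀ a b : ι × ι × ι, (U ⊗ₖ (U ⊗ₖ U)) (a.2.1, a.1, a.2.2) (b.2.1, b.1, b.2.2) = (U ⊗ₖ (U ⊗ₖ U)) a b) ∧
    (∀ a b : ι × ι × ι, (U ⊗ₖ (U ⊗ₖ U)) (a.1, a.2.2, a.2.1) (b.1, b.2.2, b.2.1) = (U ⊗ₖ (U ⊗ₖ U)) a b) ∧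
    (∀ a b : ι × ι × ι, (U ⊗ₖ (U ⊗ₖ U)) (a.2.2, a.2.1, a.1) (b.2.2, b.2.1, b.1) = (U ⊗ₖ (U ⊗ₖ U)) a b) ∧
    (∀ a b : ι × ι × ι, (U ⊗ₖ (U ⊗ₖ U)) (a.2.1, a.2.2, a.1) (b.2.1, b.2.2, b.1) = (U ⊗ₖ (U ⊗ₖ U)) a b) ∧
    (∀ a b : ι × ι × ι, (U ⊗ₖ (U ⊗ₖ U)) (a.2.2, a.1, a.2.1) (b.2.2, b.1, b.2.1) = (U ⊗ₖ (U ⊗ₖ U)) a b) := by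
  refine ⟨?_, ?_, ?_, ?_, ?_⟩ <;> rintro ⟨a₁, a₂, a₃⟩ ⟨b₁, b₂, b₃⟩ <;>
    simp only [kroneckerMap_apply] <;> ring

omit [LinearOrder ι] [Fintype ι] in
/-- The six slot permutations are bijections (three involutions, two mutually inverse 3-cycles). -/
theorem slotPerm_bijective :
    Function.Bijective (fun t : ι × ι × ι => (t.2.1, t.1, t.2.2)) ∧
    Function.Bijective (fun t : ι × ι × ι => (t.1, t.2.2, t.2.1)) ∧
    Function.Bijective (fun t : ι × ι × ι => (t.2.2, t.2.1, t.1)) ∧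
    Function.Bijective (fun t : ι × ι × ι => (t.2.1, t.2.2, t.1)) ∧
    Function.Bijective (fun t : ι × ι × ι => (t.2.2, t.1, t.2.1)) := by
  refine ⟨Function.Involutive.bijective fun _ => rfl, Function.Involutive.bijective fun _ => rfl,
    Function.Involutive.bijective fun _ => rfl,
    Function.bijective_iff_has_inverse.mpr ⟨fun t => (t.2.2, t.1, t.2.1), fun _ => rfl, fun _ => rfl⟩,
    Function.bijective_iff_has_inverse.mpr ⟨fun t => (t.2.1, t.2.2, t.1), fun _ => rfl, fun _ => rfl⟩⟩

/-- **The `T1` functional is covariant under a unitary rotation of the one-particle basis**: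
`T1(UγU†, (U⊗U)Γ(U⊗U)†) = (U⊗U⊗U) T1(γ, Γ) (U⊗U⊗U)†` (`U U† = 1`). -/
theorem t1Map_conj_unitary {U : Matrix ι ι ℂ} (hU : U * Uᴴ = 1) (γ : Matrix ι ι ℂ)
    (Γ : Matrix (ι × ι) (ι × ι) ℂ) :
    t1Map (U * γ * Uᴴ) (U ⊗ₖ U * Γ * (U ⊗ₖ U)ᴴ) =
      U ⊗ₖ (U ⊗ₖ U) * t1Map γ Γ * (U ⊗ₖ (U ⊗ₖ U))ᴴ := by
  obtain ⟨h12, h23, h13, hc, hc2⟩ := kronecker₃_perm_invariant U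
  obtain ⟨b12, b23, b13, bc, bc2⟩ := (slotPerm_bijective (ι := ι))
  have hid : ∀ a b : ι × ι × ι, (U ⊗ₖ (U ⊗ₖ U)) (id a) (id b) = (U ⊗ₖ (U ⊗ₖ U)) a b := fun _ _ => rfl
  have bid : Function.Bijective (id : ι × ι × ι → ι × ι × ι) := Function.bijective_id
  -- the three base matrices transform covariantly
  have hB1 : U ⊗ₖ (U ⊗ₖ U) * (1 : Matrix ι ι ℂ) ⊗ₖ Γ * (U ⊗ₖ (U ⊗ₖ U))ᴴ =
      (1 : Matrix ι ι ℂ) ⊗ₖ (U ⊗ₖ U * Γ * (U ⊗ₖ U)ᴴ) := by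
    rw [conjTranspose_kronecker, ← mul_kronecker_mul, ← mul_kronecker_mul, Matrix.mul_one, hU]
  have hB2 : U ⊗ₖ (U ⊗ₖ U) * (1 : Matrix ι ι ℂ) ⊗ₖ ((1 : Matrix ι ι ℂ) ⊗ₖ γ) * (U ⊗ₖ (U ⊗ₖ U))ᴴ =
      (1 : Matrix ι ι ℂ) ⊗ₖ ((1 : Matrix ι ι ℂ) ⊗ₖ (U * γ * Uᴴ)) := by
    rw [conjTranspose_kronecker, conjTranspose_kronecker, ← mul_kronecker_mul, ← mul_kronecker_mul,
      ← mul_kronecker_mul, ← mul_kronecker_mul, Matrix.mul_one, hU]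
  have hB3 : U ⊗ₖ (U ⊗ₖ U) * (1 : Matrix ι ι ℂ) ⊗ₖ ((1 : Matrix ι ι ℂ) ⊗ₖ (1 : Matrix ι ι ℂ)) *
      (U ⊗ₖ (U ⊗ₖ U))ᴴ = (1 : Matrix ι ι ℂ) ⊗ₖ ((1 : Matrix ι ι ℂ) ⊗ₖ (1 : Matrix ι ι ℂ)) := by
    rw [conjTranspose_kronecker, conjTranspose_kronecker, ← mul_kronecker_mul, ← mul_kronecker_mul,
      ← mul_kronecker_mul, ← mul_kronecker_mul, Matrix.mul_one, hU]
  rw [t1Map_eq_kronecker, t1Map_eq_kronecker]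
  simp only [Matrix.mul_sub, Matrix.mul_add, Matrix.sub_mul, Matrix.add_mul]
  simp only [conj_submatrix_of_invariant _ b12 bid h12 hid, conj_submatrix_of_invariant _ bc2 bid hc2 hid,
    conj_submatrix_of_invariant _ bid b12 hid h12, conj_submatrix_of_invariant _ b12 b12 h12 h12,
    conj_submatrix_of_invariant _ bc2 b12 hc2 h12, conj_submatrix_of_invariant _ bid bc2 hid hc2,
    conj_submatrix_of_invariant _ b12 bc2 h12 hc2, conj_submatrix_of_invariant _ bc2 bc2 hc2 hc2,
    conj_submatrix_of_invariant _ b23 bid h23 hid, conj_submatrix_of_invariant _ bid b23 hid h23,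
    conj_submatrix_of_invariant _ b23 b23 h23 h23, conj_submatrix_of_invariant _ bc bid hc hid,
    conj_submatrix_of_invariant _ b12 b23 h12 h23, conj_submatrix_of_invariant _ bc b23 hc h23,
    conj_submatrix_of_invariant _ b13 bid h13 hid, conj_submatrix_of_invariant _ bc2 b23 hc2 h23,
    conj_submatrix_of_invariant _ b13 b23 h13 h23, conj_submatrix_of_invariant _ bid bc hid hc,
    conj_submatrix_of_invariant _ b23 bc h23 hc, conj_submatrix_of_invariant _ b12 bc h12 hc,
    conj_submatrix_of_invariant _ bc bc hc hc, conj_submatrix_of_invariant _ bc2 bc hc2 hc,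
    conj_submatrix_of_invariant _ b13 bc h13 hc, hB1, hB2, hB3]

/-! ## §3 The `T2` functional and the `T2′` block matrix -/

omit [Fintype ι] in
/-- **Structural form of the `T2` functional** (Nakata et al. 2008 §II.A, 7 printed terms): the
`δ_kn Γ` term is `Γ ⊗ 1` re-associated, the four mixed terms are slot-swaps of `1 ⊗ S(Γ)` with the
reshuffle `S(Γ)_{(jk),(mn)} = Γ^{nj}_{km}`, the two `γ` terms are `1 ⊗ 1 ⊗ γᵀ` and its slot swap. -/
theorem t2Map_eq_kronecker (γ : Matrix ι ι ℂ) (Γ : Matrix (ι × ι) (ι × ι) ℂ) :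
    t2Map γ Γ =
      (Γ ⊗ₖ (1 : Matrix ι ι ℂ)).submatrix (fun t : ι × ι × ι => ((t.1, t.2.1), t.2.2))
          (fun t : ι × ι × ι => ((t.1, t.2.1), t.2.2))
      - (1 : Matrix ι ι ℂ) ⊗ₖ (Matrix.of fun p q : ι × ι => Γ (q.2, p.1) (p.2, q.1))
      + ((1 : Matrix ι ι ℂ) ⊗ₖ (Matrix.of fun p q : ι × ι => Γ (q.2, p.1) (p.2, q.1))).submatrix
          (fun t : ι × ι × ι => (t.2.1, t.1, t.2.2)) id
      + ((1 : Matrix ι ι ℂ) ⊗ₖ (Matrix.of fun p q : ι × ι => Γ (q.2, p.1) (p.2, q.1))).submatrix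
          id (fun t : ι × ι × ι => (t.2.1, t.1, t.2.2))
      - ((1 : Matrix ι ι ℂ) ⊗ₖ (Matrix.of fun p q : ι × ι => Γ (q.2, p.1) (p.2, q.1))).submatrix
          (fun t : ι × ι × ι => (t.2.1, t.1, t.2.2)) (fun t : ι × ι × ι => (t.2.1, t.1, t.2.2))
      + (1 : Matrix ι ι ℂ) ⊗ₖ ((1 : Matrix ι ι ℂ) ⊗ₖ γᵀ)
      - ((1 : Matrix ι ι ℂ) ⊗ₖ ((1 : Matrix ι ι ℂ) ⊗ₖ γᵀ)).submatrix
          (fun t : ι × ι × ι => (t.2.1, t.1, t.2.2)) id := by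
  ext ⟨i, j, k⟩ ⟨l, m, n⟩
  simp only [t2Map_apply, Matrix.sub_apply, Matrix.add_apply, submatrix_apply, id, kroneckerMap_apply,
    one_apply_symm, Matrix.of_apply, transpose_apply, @eq_comm _ n k]
  ring

omit [LinearOrder ι] in
/-- **The `T2` reshuffle is covariant**: `S((U⊗U)Γ(U⊗U)†) = (U⊗Ū) S(Γ) (U⊗Ū)†` (index re-pairing,
no unitarity). -/
theorem reshuffle₂_conj (U : Matrix ι ι ℂ) (Γ : Matrix (ι × ι) (ι × ι) ℂ) :
    (Matrix.of fun p q : ι × ι => (U ⊗ₖ U * Γ * (U ⊗ₖ U)ᴴ) (q.2, p.1) (p.2, q.1)) =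
      U ⊗ₖ U.map star * (Matrix.of fun p q : ι × ι => Γ (q.2, p.1) (p.2, q.1)) *
        (U ⊗ₖ U.map star)ᴴ := by
  ext ⟨j, k⟩ ⟨m, n⟩
  rw [Matrix.of_apply, mul_mul_apply, mul_mul_apply, ← Fintype.sum_prod_type', ← Fintype.sum_prod_type']
  refine Fintype.sum_equiv ⟨fun z => ((z.1.2, z.2.1), (z.2.2, z.1.1)),
    fun z => ((z.2.2, z.1.1), (z.1.2, z.2.1)), fun _ => rfl, fun _ => rfl⟩ _ _ fun z => ?_
  simp only [Equiv.coe_fn_mk, Matrix.of_apply, conjTranspose_apply, kroneckerMap_apply, map_apply,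
    star_mul', star_star]
  ring

/-- **The `T2` functional is covariant under a unitary rotation of the one-particle basis**:
`T2(UγU†, (U⊗U)Γ(U⊗U)†) = (U⊗U⊗Ū) T2(γ, Γ) (U⊗U⊗Ū)†` — two particle slots and one hole slot
(`U U† = 1`). -/
theorem t2Map_conj_unitary {U : Matrix ι ι ℂ} (hU : U * Uᴴ = 1) (γ : Matrix ι ι ℂ)
    (Γ : Matrix (ι × ι) (ι × ι) ℂ) :
    t2Map (U * γ * Uᴴ) (U ⊗ₖ U * Γ * (U ⊗ₖ U)ᴴ) =
      U ⊗ₖ (U ⊗ₖ U.map star) * t2Map γ Γ * (U ⊗ₖ (U ⊗ₖ U.map star))ᴴ := by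
  obtain ⟨b12, -, -, -, -⟩ := (slotPerm_bijective (ι := ι))
  have hV : U.map star * (U.map star)ᴴ = 1 := map_star_mul_conjTranspose_of_unitary hU
  have h12 : ∀ a b : ι × ι × ι, (U ⊗ₖ (U ⊗ₖ U.map star)) (a.2.1, a.1, a.2.2) (b.2.1, b.1, b.2.2) =
      (U ⊗ₖ (U ⊗ₖ U.map star)) a b := by
    rintro ⟨a₁, a₂, a₃⟩ ⟨b₁, b₂, b₃⟩
    simp only [kroneckerMap_apply]
    ring
  have hid : ∀ a b : ι × ι × ι, (U ⊗ₖ (U ⊗ₖ U.map star)) (id a) (id b) =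
      (U ⊗ₖ (U ⊗ₖ U.map star)) a b := fun _ _ => rfl
  have bid : Function.Bijective (id : ι × ι × ι → ι × ι × ι) := Function.bijective_id
  have hassoc : ∀ a b : ι × ι × ι, (U ⊗ₖ (U ⊗ₖ U.map star)) a b =
      ((U ⊗ₖ U) ⊗ₖ U.map star) ((a.1, a.2.1), a.2.2) ((b.1, b.2.1), b.2.2) := by
    rintro ⟨a₁, a₂, a₃⟩ ⟨b₁, b₂, b₃⟩
    simp only [kroneckerMap_apply]
    ring
  have bassoc : Function.Bijective (fun t : ι × ι × ι => ((t.1, t.2.1), t.2.2)) :=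
    Function.bijective_iff_has_inverse.mpr ⟨fun p => (p.1.1, p.1.2, p.2), fun _ => rfl, fun _ => rfl⟩
  have hB1 : (U ⊗ₖ U) ⊗ₖ U.map star * Γ ⊗ₖ (1 : Matrix ι ι ℂ) * ((U ⊗ₖ U) ⊗ₖ U.map star)ᴴ =
      (U ⊗ₖ U * Γ * (U ⊗ₖ U)ᴴ) ⊗ₖ (1 : Matrix ι ι ℂ) := by
    rw [conjTranspose_kronecker ((U ⊗ₖ U)) (U.map star), ← mul_kronecker_mul, ← mul_kronecker_mul,
      Matrix.mul_one, hV]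
  have hB2 : U ⊗ₖ (U ⊗ₖ U.map star) *
        (1 : Matrix ι ι ℂ) ⊗ₖ (Matrix.of fun p q : ι × ι => Γ (q.2, p.1) (p.2, q.1)) *
        (U ⊗ₖ (U ⊗ₖ U.map star))ᴴ =
      (1 : Matrix ι ι ℂ) ⊗ₖ
        (Matrix.of fun p q : ι × ι => (U ⊗ₖ U * Γ * (U ⊗ₖ U)ᴴ) (q.2, p.1) (p.2, q.1)) := by
    rw [conjTranspose_kronecker U (U ⊗ₖ U.map star), ← mul_kronecker_mul, ← mul_kronecker_mul,
      Matrix.mul_one, hU, reshuffle₂_conj]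
  have hB3 : U ⊗ₖ (U ⊗ₖ U.map star) * (1 : Matrix ι ι ℂ) ⊗ₖ ((1 : Matrix ι ι ℂ) ⊗ₖ γᵀ) *
        (U ⊗ₖ (U ⊗ₖ U.map star))ᴴ =
      (1 : Matrix ι ι ℂ) ⊗ₖ ((1 : Matrix ι ι ℂ) ⊗ₖ (U * γ * Uᴴ)ᵀ) := by
    rw [conjTranspose_kronecker U (U ⊗ₖ U.map star), conjTranspose_kronecker U (U.map star),
      ← mul_kronecker_mul, ← mul_kronecker_mul, ← mul_kronecker_mul, ← mul_kronecker_mul,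
      Matrix.mul_one, hU, transpose_conj]
  rw [t2Map_eq_kronecker, t2Map_eq_kronecker]
  simp only [Matrix.mul_sub, Matrix.mul_add, Matrix.sub_mul, Matrix.add_mul]
  simp only [conj_submatrix_of_eq _ bassoc hassoc, conj_submatrix_of_invariant _ b12 bid h12 hid,
    conj_submatrix_of_invariant _ bid b12 hid h12, conj_submatrix_of_invariant _ b12 b12 h12 h12,
    hB1, hB2, hB3]

omit [LinearOrder ι] in
/-- The upper-right block of `T2′`, `X_{(ijk), l} = Γ^{ij}_{lk}`, is covariant:
`X' = (U⊗U⊗Ū) X U†`. -/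
theorem t2PrimeBlock₁₂_conj (U : Matrix ι ι ℂ) (Γ : Matrix (ι × ι) (ι × ι) ℂ) :
    (Matrix.of fun (I : ι × ι × ι) (l : ι) => (U ⊗ₖ U * Γ * (U ⊗ₖ U)ᴴ) (I.1, I.2.1) (l, I.2.2)) =
      U ⊗ₖ (U ⊗ₖ U.map star) * (Matrix.of fun (I : ι × ι × ι) (l : ι) => Γ (I.1, I.2.1) (l, I.2.2)) *
        Uᴴ := by
  ext ⟨i, j, k⟩ l
  rw [Matrix.of_apply, mul_mul_apply, mul_mul_apply', ← Fintype.sum_prod_type',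
    ← Fintype.sum_prod_type']
  refine Fintype.sum_equiv ⟨fun z => (z.1.1, (z.2.1, z.2.2, z.1.2)),
    fun z => ((z.1, z.2.2.2), (z.2.1, z.2.2.1)), fun _ => rfl, fun _ => rfl⟩ _ _ fun z => ?_
  simp only [Equiv.coe_fn_mk, Matrix.of_apply, conjTranspose_apply, kroneckerMap_apply, map_apply,
    star_mul']
  ring

omit [LinearOrder ι] in
/-- The lower-left block of `T2′`, `Y_{l, (ijk)} = Γ^{lk}_{ij}`, is covariant: `Y' = U Y (U⊗U⊗Ū)†`. -/
theorem t2PrimeBlock₂₁_conj (U : Matrix ι ι ℂ) (Γ : Matrix (ι × ι) (ι × ι) ℂ) :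
    (Matrix.of fun (l : ι) (I : ι × ι × ι) => (U ⊗ₖ U * Γ * (U ⊗ₖ U)ᴴ) (l, I.2.2) (I.1, I.2.1)) =
      U * (Matrix.of fun (l : ι) (I : ι × ι × ι) => Γ (l, I.2.2) (I.1, I.2.1)) *
        (U ⊗ₖ (U ⊗ₖ U.map star))ᴴ := by
  ext l ⟨i, j, k⟩
  rw [Matrix.of_apply, mul_mul_apply, mul_mul_apply', ← Fintype.sum_prod_type',
    ← Fintype.sum_prod_type']
  refine Fintype.sum_equiv ⟨fun z => ((z.1.1, z.1.2, z.2.2), z.2.1),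
    fun z => ((z.1.1, z.1.2.1), (z.2, z.1.2.2)), fun _ => rfl, fun _ => rfl⟩ _ _ fun z => ?_
  simp only [Equiv.coe_fn_mk, Matrix.of_apply, conjTranspose_apply, kroneckerMap_apply, map_apply,
    star_mul', star_star]
  ring

/-- **The `T2′` block matrix is covariant under a unitary rotation of the one-particle basis**:
`T2′(UγU†, (U⊗U)Γ(U⊗U)†) = D T2′(γ, Γ) D†` with the block-diagonal `D = (U⊗U⊗Ū) ⊕ U`
(Nakata et al. 2008 §II.B; `U U† = 1`). -/
theorem t2PrimeMap_conj_unitary {U : Matrix ι ι ℂ} (hU : U * Uᴴ = 1) (γ : Matrix ι ι ℂ)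
    (Γ : Matrix (ι × ι) (ι × ι) ℂ) :
    t2PrimeMap (U * γ * Uᴴ) (U ⊗ₖ U * Γ * (U ⊗ₖ U)ᴴ) =
      Matrix.fromBlocks (U ⊗ₖ (U ⊗ₖ U.map star)) 0 0 U * t2PrimeMap γ Γ *
        (Matrix.fromBlocks (U ⊗ₖ (U ⊗ₖ U.map star)) 0 0 U)ᴴ := by
  rw [t2PrimeMap, t2PrimeMap, fromBlocks_conjTranspose, fromBlocks_multiply, fromBlocks_multiply]
  simp only [Matrix.zero_mul, Matrix.mul_zero, add_zero, zero_add, conjTranspose_zero]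
  rw [t2Map_conj_unitary hU, t2PrimeBlock₁₂_conj, t2PrimeBlock₂₁_conj]

/-! ## §4 Invariance of the `PQGT1T2′`-feasible set -/

/-- **The `PQGT1T2′`-feasible set (`N`-electron form) is invariant under unitary rotations of the
one-particle basis**: the DQG part by `isDQGFeasible_conj_unitary`, the `T1` cone by the
`U⊗U⊗U`-congruence, the `T2′` cone by the `(U⊗U⊗Ū) ⊕ U`-congruence. -/
theorem isDQGT1T2PrimeFeasible_conj_unitary {U : Matrix ι ι ℂ} (hU : U * Uᴴ = 1) {N : ℕ}
    {γ : Matrix ι ι ℂ} {Γ : Matrix (ι × ι) (ι × ι) ℂ} (h : IsDQGT1T2PrimeFeasible N γ Γ) :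
    IsDQGT1T2PrimeFeasible N (U * γ * Uᴴ) (U ⊗ₖ U * Γ * (U ⊗ₖ U)ᴴ) where
  toIsDQGFeasible := isDQGFeasible_conj_unitary hU h.toIsDQGFeasible
  t1_psd := by
    rw [t1Map_conj_unitary hU]
    exact h.t1_psd.mul_mul_conjTranspose_same _
  t2Prime_psd := by
    rw [t2PrimeMap_conj_unitary hU]
    exact h.t2Prime_psd.mul_mul_conjTranspose_same _

end ThreeIndex

end Summit.Ventures.CertifiedQuantumChemistry

end
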